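import Literature.AlgebraicGeometry.Frobenioids.ArithmeticFrobenioidHypotheses
import Literature.AlgebraicGeometry.Frobenioids.ArithmeticDivisorsPrimes
import Literature.AlgebraicGeometry.Frobenioids.ModelFrobenioidTypeBridge
import HarnessLib

/-!
# Frobenioids I, Theorem 6.4 (i): the arithmetic divisor monoid `Φ` is non-dilating; `C_{K/F}` is of
# standard type (modulo Thm. 5.2 (iii)) — PROOF

Mochizuki, *The geometry of Frobenioids I: the general theory*, Kyushu J. Math. **62** (2008) 293–400,
proof of Theorem 6.4 (i), kurims text p. 115: "`Φ` is nonzero [so `C` is not of group-like type] and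
perf-factorial. As was observed in the proof of Theorem 6.2, (iii), (iv), `D` is Frobenius-slim and of FSM-type,
hence also of FSMFF-type … it follows immediately that `Φ` is non-dilating, and that `D` is Div-slim … so `C` is
of standard type"; the parallel passage of the proof of Theorem 6.2 (iii), pp. 111–112: "If a `K`-linear
automorphism `α` of a finite extension `L ⊆ K̃` of `K` induces an automorphism of `Φ(L)` which preserves the
primes of `L`, then … `α` maps every prime divisor `D ∈ Φ(L)` to `D` [i.e., not to some `n · D`, where `n ≥ 2`];
thus, we conclude that `Φ` is non-dilating". [cite: MochizukiFrdI2008, Thm. 6.4 (i) p.115]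

PROOF-ONLY companion (seat abc-iut-L6-t10) for THE constructed arithmetic model `arithFrobenioid F K`
(`ArithmeticFrobenioidModel.lean`), over abc-iut-L1-t3's `ArithmeticDivisors` / `FinSubextCat`, the tree's
`IsNonDilating(On)` (`ElementaryFrobenioid.lean`, Def. 1.1 (i)/(ii)) and `ArithmeticDivisorsPrimes.lean`
(primary elements of `Φ(L)` = divisors supported at one place). PROVED:
* `eq_self_of_iterate_eq_id_of_le` — an order-theoretic lemma: a monotone self-map of finite order that is
  pointwise increasing is the identity (the kernel of "not to some `n · D`, `n ≥ 2`");
* `isNonDilating_of_forall_isPrimary` — reduction of Def. 1.1 (i) (stated on `M^char`) to the primary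
  elements of a sharp monoid `M`;
* `EffArithDivisor.pullback_eq_self_of_precsim` — for an `F`-endomorphism `σ` of a number field `L` finite
  over `F`: if `σ^* δ_v ≼ δ_v` for every place `v` (`δ_v` the divisor with coefficient `1` at `v`), then
  `σ^* = id` on `Φ(L)` (`σ` has finite order; `σ` fixes every place; `σ^* D ≥ D`);
* `arithDivisorFunctor_isNonDilatingOn : IsNonDilatingOn (arithDivisorFunctor F K)` — **`Φ` is non-dilating**;
* `not_isZeroMonoid_arith` — `Φ` is not the zero monoid (clause (a) of Thm. 5.2 (iii) is vacuous);
* `isOfStandardType_arith_of` — **`C_{K/F}` is of standard type**, CONDITIONAL on abc-iut-L1-t2's named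
  statement `ModelFrobenioid.StandardTypeIff` (Thm. 5.2 (iii), first sentence; its discharge
  `standardTypeIff_holds` is staged by abc-iut-L1-t2): clauses (a) vacuous, (b) `D` of FSMFF-type
  (`FinSubextCat.isOfFSMFFType`), (c) `Φ` non-dilating.
No definitions; nothing here bears on [IUTchIII] or asserts anything about abc.
-/

noncomputable section

namespace Literature.AlgebraicGeometry.Frobenioids

open CategoryTheory Opposite NumberField Function

universe u

/-! ### Two general lemmas -/

/-- A monotone self-map `P` of a partial order with `P^m = id` for some `m ≥ 1` and `D ≤ P D` for all `D` is
the identity: `D ≤ P D ≤ P² D ≤ ⋯ ≤ P^m D = D` (the kernel of "`α` maps `D` to `D`, not to some `n · D`,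
`n ≥ 2`", FrdI p. 112). [cite: MochizukiFrdI2008, Thm. 6.2 (iii) p.112] -/
theorem eq_self_of_iterate_eq_id_of_le {α : Type u} [PartialOrder α] {P : α → α} (hmono : Monotone P)
    {m : ℕ} (hm : 0 < m) (hiter : P^[m] = id) (hle : ∀ D, D ≤ P D) (D : α) : P D = D := by
  have hchain : Monotone fun k => P^[k] D := by
    refine monotone_nat_of_le_succ fun k => ?_
    rw [iterate_succ_apply]
    exact hmono.iterate k (hle D)
  have h := hchain (show 1 ≤ m from hm)
  simp only [iterate_one, hiter, id_eq] at h
  exact le_antisymm h (hle D)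

/-- Reduction of Def. 1.1 (i) to primary elements of `M` itself, for a SHARP monoid `M` (`M → M^char` is then
compatible with `≼` and primary elements): if "`φ(a) ≼ a` for all primary `a ∈ M`" forces `φ = id`, then `φ`
is non-dilating. [cite: MochizukiFrdI2008, Def. 1.1 (i) p.19] -/
theorem isNonDilating_of_forall_isPrimary {M : Type u} [CommMonoid M] (hM : IsSharp M) (φ : M →* M)
    (h : (∀ a : M, IsPrimary a → φ a ≼ a) → φ = MonoidHom.id M) : IsNonDilating φ := by
  intro H
  have hprec : ∀ {a b : M}, Associates.mk a ≼ Associates.mk b → a ≼ b := fun ⟨n, hn, hdvd⟩ =>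
    ⟨n, hn, by rwa [← Associates.mk_pow, Associates.mk_dvd_mk] at hdvd⟩
  have hprec' : ∀ {a b : M}, a ≼ b → Associates.mk a ≼ Associates.mk b := fun ⟨n, hn, hdvd⟩ =>
    ⟨n, hn, by rwa [← Associates.mk_pow, Associates.mk_dvd_mk]⟩
  have hprim : ∀ {a : M}, IsPrimary a → IsPrimary (Associates.mk a) := fun {a} ha => by
    refine ⟨fun h1 => ha.1 (hM.1 a (Associates.mk_eq_one.mp h1)), fun b hb hba => ?_⟩
    obtain ⟨b, rfl⟩ := Associates.mk_surjective b
    have hb' : b ≠ 1 := fun h => hb (by rw [h, Associates.mk_one])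
    exact hprec' (ha.2 b hb' (hprec hba))
  have hφ : φ = MonoidHom.id M := h fun a ha => by
    have := H _ (hprim ha)
    rw [associatesMap_mk] at this
    exact hprec this
  rw [hφ]
  ext x
  obtain ⟨a, rfl⟩ := Associates.mk_surjective x
  rw [associatesMap_mk]
  rfl

/-! ### An endomorphism of `Spec L` whose pull-back preserves the primes of `Φ(L)` pulls back trivially -/

namespace EffArithDivisor

variable {F : Type} [Field F] {L : Type} [Field L] [Algebra F L] [FiniteDimensional F L]

/-- An `F`-algebra endomorphism of a field `L` finite over `F` has finite order: some iterate `σ^m`, `m ≥ 1`,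
is the identity. [cite: MochizukiFrdI2008, Thm. 6.2 (iii) p.111] -/
theorem exists_iterate_eq_id (σ : L →ₐ[F] L) : ∃ m : ℕ, 0 < m ∧ (σ : L → L)^[m] = id := by
  let e : L ≃ₐ[F] L := AlgEquiv.ofBijective σ (Algebra.IsAlgebraic.algHom_bijective σ)
  refine ⟨orderOf e, orderOf_pos e, ?_⟩
  have h : ((e ^ orderOf e : L ≃ₐ[F] L) : L → L) = id := by rw [pow_orderOf_eq_one]; rfl
  rwa [AlgEquiv.coe_pow] at h

variable [NumberField L]

/-- Pull-back is monotone for the coordinatewise order on `Φ(L)` (it is additive).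
[cite: MochizukiFrdI2008, Ex. 6.3 p.113] -/
theorem pullback_monotone {M : Type} [Field M] [NumberField M] (σ : M →+* L) :
    Monotone (EffArithDivisor.pullback σ) := fun D E h =>
  ⟨fun w => by rw [pullback_fst, pullback_fst]; exact Nat.mul_le_mul_left _ (h.1 _),
    fun w => by rw [pullback_snd, pullback_snd]; exact h.2 _⟩

/-- **Key step of Thm. 6.4 (i) / 6.2 (iii)** ("if `α` induces an automorphism of `Φ(L)` which preserves the
primes of `L`, then `α` maps every prime divisor `D` to `D` [not to some `n · D`, `n ≥ 2`]", FrdI pp. 111–112):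
for an `F`-endomorphism `σ` of a number field `L` finite over `F`, if `σ^* δ_v ≼ δ_v` for every place `v`, then
`σ^*` is the identity on `Φ(L)`. PROOF: `σ` has finite order `m`; the support condition forces `σ` to fix every
place (below each place lies only itself); hence `(σ^* D)_v = e_v · D_v ≥ D_v` at finite `v` and
`(σ^* D)_w = D_w` at archimedean `w`, so `D ≤ σ^* D ≤ ⋯ ≤ (σ^*)^m D = D`. [cite: MochizukiFrdI2008, Thm. 6.4 (i) p.115] -/
theorem pullback_eq_self_of_precsim (σ : L →ₐ[F] L)
    (h : ∀ p : Places L, Precsim (Multiplicative.ofAdd (EffArithDivisor.pullback (σ : L →+* L) (single L p)))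
      (Multiplicative.ofAdd (single L p)))
    (D : EffArithDivisor L) : EffArithDivisor.pullback (σ : L →+* L) D = D := by
  classical
  obtain ⟨m, hm, hiter⟩ := exists_iterate_eq_id σ
  -- (1) `σ` fixes every finite place and every archimedean place
  have hfin : ∀ v : FinitePlace L, ArithPullback.underPlace (σ : L →+* L) v = v := fun v => by
    obtain ⟨w, hw⟩ := ArithPullback.underPlace_surjective (σ : L →+* L) v
    have hsub := precsim_iff_psupp_subset.mp (h (Sum.inr v))
    rw [psupp_single] at hsub
    have hmem : (Sum.inr w : Places L) ∈ psupp (EffArithDivisor.pullback (σ : L →+* L) (single L (Sum.inr v))) := by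
      rw [inr_mem_psupp, pullback_fst, hw]
      simp only [single, Finsupp.single_eq_same, mul_one]
      exact ArithPullback.ramIdx_ne_zero _ _
    have := hsub hmem
    rw [Set.mem_singleton_iff, Sum.inr.injEq] at this
    rw [← this, hw, this]
  have hinf : ∀ w : InfinitePlace L, w.comap (σ : L →+* L) = w := fun w => by
    obtain ⟨w', hw'⟩ := ArithPullback.comap_infinitePlace_surjective (σ : L →+* L) w
    have hw' : w'.comap (σ : L →+* L) = w := hw'
    have hsub := precsim_iff_psupp_subset.mp (h (Sum.inl w))
    rw [psupp_single] at hsub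
    have hmem : (Sum.inl w' : Places L) ∈ psupp (EffArithDivisor.pullback (σ : L →+* L) (single L (Sum.inl w))) := by
      rw [inl_mem_psupp, pullback_snd, hw']
      simp [single]
    have := hsub hmem
    rw [Set.mem_singleton_iff, Sum.inl.injEq] at this
    rw [this] at hw'
    exact hw'
  -- (2) hence `D ≤ σ^* D`
  have hle : ∀ D : EffArithDivisor L, D ≤ EffArithDivisor.pullback (σ : L →+* L) D := fun D => by
    refine ⟨fun v => ?_, fun w => ?_⟩
    · rw [pullback_fst, hfin]
      exact Nat.le_mul_of_pos_left _ (Nat.pos_of_ne_zero (ArithPullback.ramIdx_ne_zero _ _))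
    · rw [pullback_snd, hinf]
  -- (3) `(σ^*)^m = id`
  have hpow : ∀ k : ℕ, (EffArithDivisor.pullback (σ : L →+* L))^[k] =
      EffArithDivisor.pullback (((σ : L →+* L) ^ k : L →+* L)) := by
    intro k
    induction k with
    | zero =>
      funext E
      rw [iterate_zero, id_eq, pow_zero]
      exact (EffArithDivisor.pullback_id E).symm
    | succ k ih =>
      funext E
      rw [iterate_succ_apply', ih, pow_succ', RingHom.mul_def, EffArithDivisor.pullback_comp]
  have hσm : ((σ : L →+* L) ^ m : L →+* L) = RingHom.id L := by
    refine RingHom.ext fun x => ?_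
    rw [RingHom.coe_pow]
    exact congrFun hiter x
  have hiter' : (EffArithDivisor.pullback (σ : L →+* L))^[m] = id := by
    rw [hpow, hσm]
    funext E
    exact EffArithDivisor.pullback_id E
  exact eq_self_of_iterate_eq_id_of_le (pullback_monotone _) hm hiter' hle D

end EffArithDivisor

/-! ### `Φ` is non-dilating; `C_{K/F}` is of standard type -/

section StandardType

variable (F : Type) [Field F] [NumberField F] (K : Type) [Field K] [Algebra F K]

/-- **Theorem 6.4 (i), proof: "`Φ` is non-dilating"** (FrdI p. 115; Def. 1.1 (ii)) — PROVED for the arithmetic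
divisor monoid `Φ` of Example 6.3 on `D = B(Gal(K/F))⁰`: an endomorphism of `Spec L` in `D` is an `F`-algebra
endomorphism `σ` of `L`, and if `σ^*` maps every primary element of `Φ(L)` (a divisor supported at a single
place, `EffArithDivisor.isPrimary_iff`) into its own `≼`-class, then `σ^* = id`
(`EffArithDivisor.pullback_eq_self_of_precsim`). [cite: MochizukiFrdI2008, Thm. 6.4 (i) p.115] -/
theorem arithDivisorFunctor_isNonDilatingOn : IsNonDilatingOn (arithDivisorFunctor F K) := by
  intro A α
  refine isNonDilating_of_forall_isPrimary (EffArithDivisor.isDivisorial A.L).isSharp _ fun H => ?_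
  have key : ∀ D : EffArithDivisor A.L,
      EffArithDivisor.pullback (α.toAlgHom : A.L →+* A.L) D = D :=
    EffArithDivisor.pullback_eq_self_of_precsim α.toAlgHom fun p =>
      H (Multiplicative.ofAdd (EffArithDivisor.single A.L p)) (EffArithDivisor.isPrimary_single p)
  refine MonoidHom.ext fun x => ?_
  change Multiplicative.ofAdd (EffArithDivisor.pullback (α.toAlgHom : A.L →+* A.L) (Multiplicative.toAdd x)) = x
  rw [key, ofAdd_toAdd]

/-- The operations of `C_{K/F}` are non-dilating (abc-iut-L1-t3's rendering `PreFrobenioidData.IsNonDilatingOn`,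
via abc-iut-L1-t2's bridge `ModelFrobenioid.data_isNonDilatingOn_iff`). [cite: MochizukiFrdI2008, Thm. 6.4 (i) p.115] -/
theorem arithFrobenioidOps_isNonDilatingOn : (arithFrobenioidOps F K).IsNonDilatingOn := by
  rw [show arithFrobenioidOps F K = ModelFrobenioid.data _ _ _ from ModelFrobenioid.ofModel_eq_data _ _ _,
    ModelFrobenioid.data_isNonDilatingOn_iff]
  exact arithDivisorFunctor_isNonDilatingOn F K

/-- **Theorem 6.4 (i), proof: "`Φ` is nonzero"** (FrdI p. 115) — `Φ` is not the zero monoid (the divisor `δ_v`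
at any place of `F` is nonzero), so clause (a) of Thm. 5.2 (iii) is vacuous. [cite: MochizukiFrdI2008, Thm. 6.4 (i) p.115] -/
theorem not_isZeroMonoid_arith : ¬ ModelFrobenioid.IsZeroMonoid (arithDivisorFunctor F K) := by
  intro h
  obtain ⟨B⟩ := (FinSubextCat.isGraphConnected F K).nonempty
  obtain ⟨w⟩ : Nonempty (InfinitePlace B.L) := inferInstance
  have h1 := h (op B) (Multiplicative.ofAdd (EffArithDivisor.single B.L (Sum.inl w)))
  have h2 : EffArithDivisor.psupp (EffArithDivisor.single B.L (Sum.inl w)) = ∅ :=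
    EffArithDivisor.psupp_eq_empty_iff.mpr (Multiplicative.ofAdd.injective h1)
  rw [EffArithDivisor.psupp_single] at h2
  exact Set.singleton_ne_empty _ h2

variable [IsGalois F K]

/-- **Theorem 6.4 (i): "`C` is of standard type"** (FrdI p. 114; proof p. 115: `Φ ≠ 0`, `D` of FSMFF-type, `Φ`
non-dilating) — PROVED for THE constructed `C_{K/F}` CONDITIONALLY on abc-iut-L1-t2's named statement of
Thm. 5.2 (iii) (first sentence), `ModelFrobenioid.StandardTypeIff`: its three clauses are discharged here —
(a) vacuous (`not_isZeroMonoid_arith`), (b) `FinSubextCat.isOfFSMFFType`, (c) `arithDivisorFunctor_isNonDilatingOn` —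
and its standing hypotheses are `arith_hypotheses`. [cite: MochizukiFrdI2008, Thm. 6.4 (i) p.114] -/
theorem isOfStandardType_arith_of
    (h52 : ModelFrobenioid.StandardTypeIff (arithDivisorFunctor F K) (unitsFunctor F K) (divNatTrans F K)) :
    (arithFrobenioidOps F K).IsOfStandardType := by
  rw [show arithFrobenioidOps F K = ModelFrobenioid.data _ _ _ from ModelFrobenioid.ofModel_eq_data _ _ _]
  exact (h52 (arith_hypotheses F K)).mpr
    ⟨fun h0 => (not_isZeroMonoid_arith F K h0).elim, FinSubextCat.isOfFSMFFType F K,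
      arithDivisorFunctor_isNonDilatingOn F K⟩

end StandardType

end Literature.AlgebraicGeometry.Frobenioids

end
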